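import Literature.AnabelianGeometry.AbsoluteAnabelian.AbsTopIProp23iAlmostProSigmaHyperbolic
import Literature.AnabelianGeometry.AbsoluteAnabelian.AbsTopIProp23PuncturedSurfaceModelProofs
import Literature.AnabelianGeometry.AbsoluteAnabelian.AbsTopIProp23ClosedSurfaceModelProofs
import Literature.AnabelianGeometry.AbsoluteAnabelian.ProfiniteTFGAscent
import HarnessLib

/-!
# [AbsTopI] Prop 2.2 / Prop 2.3 (i)(ii) at the ALMOST pro-`Σ` surface-group model (MLF / NF base)

S. Mochizuki, *Topics in Absolute Anabelian Geometry I: Generalities* (2012) [AbsTopI] (lit key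
`paper:url-11ac98ba15fc`), Prop 2.2 p. 18 ("`Δ` … topologically finitely generated"), Prop 2.3 p. 19 ((i) "`Δ` is
slim and elastic"; (ii) for `1 → Δ → Π → G → 1` of GSAFG-type over an MLF or NF: "`Π` is slim, but not elastic").
The tree proves the three node predicates `E.GeomTFG`, `E.GeomSlimElastic`, `E.ArithSlimNotElastic` at the PRO-`Σ`
surface-group model (abc-iut-L4-d1 `prop22_prop23_of_isProSigmaCompletion_closedSurfaceGroup_mlf/_nf`, abc-iut-w5-d206
`prop22_prop23_of_isProSigmaCompletion_puncturedSurfaceGroup_mlf/_nf`).  This PROOF-ONLY file (no definition, no named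
fact) lifts them to the ALMOST pro-`Σ` model of Def 2.1 (i) — `Δ` with an OPEN subgroup `U` presented as a pro-`Σ`
completion of a hyperbolic surface group `Γ_{g,r}` — GIVEN (FN) «`Δ` has no nontrivial finite normal subgroup»
(necessary: `ProfiniteSlimAscentSharp.lean`):

* `nontrivial_of_isProSigmaCompletion_hyperbolic` — such a `U` is nontrivial (`δ¹_ℓ(U) ≥ 1`), so `Δ ≠ 1`;
* `prop22_prop23_of_isOpen_proSigma_hyperbolic_mlf` / `_nf` — `E.GeomTFG ∧ E.GeomSlimElastic ∧ E.ArithSlimNotElastic`: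
  Prop 2.2 by the t.f.g. ascent (`geomTFG_of_isOpen_subgroup`, abc-iut-w6-d071 `ProfiniteTFGAscent.lean`), Prop 2.3 (i)
  by `geomSlimElastic_of_isOpen_proSigma_hyperbolic` (ascents of slimness/elasticity), Prop 2.3 (ii) by abc-iut-L4-t4/d1's
  `MLFBase.arithSlimNotElastic'` / `NFBase.arithSlimNotElastic'`.

HONEST SCOPE: model-level; (FN) explicit; orbicurves / `char k ∈ Σ` outside the model.  Classical; OUR kernel check;
nothing here bears on [IUTchIII] Cor. 3.12.
-/

noncomputable section

open Topology

namespace Literature.AnabelianGeometry.AbsoluteAnabelian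

open Literature.AlgebraicGeometry.Frobenioids (IsSlimGroup)
open Literature.AnabelianGeometry.SemiGraphs.SemiGraphOfAnabelioids
open Literature.GroupTheory.CombinatorialGroupTheory

/-- A pro-`Σ` completion `P` of a surface group of hyperbolic type (`Σ` containing a prime `ℓ`) is NONTRIVIAL:
`δ¹_ℓ(P) = 2g` (closed class, `g ≥ 2`) resp. `2g + r − 1 ≥ 2` (punctured class), so `P` surjects continuously onto
some `ℤ_ℓ^N`, `N ≥ 1` (the rank route of `geom_ne_bot_of_isProSigmaCompletion_closed/puncturedSurfaceGroup`, for an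
arbitrary profinite carrier). [cite: MochizukiAbsTopI2012, Prop 2.3 (i) p.19] -/
theorem nontrivial_of_isProSigmaCompletion_hyperbolic {P : Type} [Group P] [TopologicalSpace P]
    [IsTopologicalGroup P] [CompactSpace P] [T2Space P] [TotallyDisconnectedSpace P] {Sigma : Set ℕ}
    (hS : ∃ ℓ ∈ Sigma, ℓ.Prime) {g r : ℕ} (hgr : PuncturedSurfaceGroup.IsHyperbolicType g r)
    (ι : PuncturedSurfaceGroup g r →* P) (hι : IsProSigmaCompletion Sigma ι) : Nontrivial P := by
  classical
  obtain ⟨ℓ, hℓS, hℓ⟩ := hS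
  haveI : Fact ℓ.Prime := ⟨hℓ⟩
  have h1 : ((1 : ℕ) : ℕ∞) ≤ freeProlRank P ℓ := by
    rcases Nat.eq_zero_or_pos r with hr | hr
    · subst hr
      have hg : 2 ≤ g := by
        unfold PuncturedSurfaceGroup.IsHyperbolicType at hgr
        omega
      obtain ⟨e⟩ := IsProSigmaCompletion.nonempty_mulEquiv_puncturedSurfaceGroup_zero g
      rw [IsProSigmaCompletion.freeProlRank_eq_of_surfaceGroup hι e hℓS]
      exact_mod_cast (by omega : 1 ≤ 2 * g)
    · obtain ⟨r', rfl⟩ : ∃ r', r = r' + 1 := ⟨r - 1, by omega⟩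
      obtain ⟨e⟩ := PuncturedSurfaceGroup.nonempty_mulEquiv_freeGroup g r'
      have hι' : IsProSigmaCompletion Sigma (ι.comp e.symm.toMonoidHom) :=
        hι.of_comp_mulEquiv e.symm (fun _ => rfl)
      rw [freeProlRank_eq_card_of_isProSigmaCompletion_freeGroup hι' hℓS]
      have hh : 2 < 2 * g + (r' + 1) := hgr
      have hcard : 1 ≤ Fintype.card ((Fin g × Bool) ⊕ Fin r') := by
        simp only [Fintype.card_sum, Fintype.card_prod, Fintype.card_fin, Fintype.card_bool]
        omega
      exact_mod_cast hcard
  obtain ⟨N, F, hN, hF⟩ := exists_surjective_of_le_freeProlRank ℓ Nat.one_pos h1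
  haveI : Nonempty (Fin N) := ⟨⟨0, by omega⟩⟩
  haveI : Nontrivial (Multiplicative (Fin N → ℤ_[ℓ])) := Multiplicative.ofAdd.injective.nontrivial
  exact hF.nontrivial

namespace FundamentalExtension

variable {E : FundamentalExtension.{0}} {Sigma : Set ℕ} {g r : ℕ}

/-- `Δ ≠ 1` at the almost pro-`Σ` model: an open subgroup of `Δ` that is a pro-`Σ` completion of a hyperbolic surface
group is nontrivial. [cite: MochizukiAbsTopI2012, Prop 2.3 (ii) p.19] -/
theorem geom_ne_bot_of_isOpen_proSigma_hyperbolic (E : FundamentalExtension.{0}) (hS : ∃ ℓ ∈ Sigma, ℓ.Prime)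
    (hgr : PuncturedSurfaceGroup.IsHyperbolicType g r) (U : Subgroup E.geom) (hUo : IsOpen (U : Set E.geom))
    (ι : PuncturedSurfaceGroup g r →* U) (hι : IsProSigmaCompletion Sigma ι) : E.geom ≠ ⊥ := by
  haveI : CompactSpace E.geom := isCompact_iff_compactSpace.mp E.isClosed_geom.isCompact
  haveI : CompactSpace U := isCompact_iff_compactSpace.mp (Subgroup.isClosed_of_isOpen U hUo).isCompact
  haveI : Nontrivial U := nontrivial_of_isProSigmaCompletion_hyperbolic hS hgr ι hι
  obtain ⟨⟨x, hxU⟩, hx⟩ := exists_ne (1 : U)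
  rw [← Subgroup.nontrivial_iff_ne_bot]
  refine ⟨⟨x, 1, fun h => hx (Subtype.ext ?_)⟩⟩
  simpa using h

/-- **[AbsTopI] Prop 2.2 + Prop 2.3 (i) + Prop 2.3 (ii) at the ALMOST pro-`Σ` model, MLF base**: for an extension
`1 → Δ → Π → G → 1` with MLF base data whose `Δ` has no nontrivial finite normal subgroup and contains an OPEN subgroup
presented as a pro-`Σ` completion of a hyperbolic `Γ_{g,r}` (`Σ` a nonempty set of primes): `Δ` is t.f.g., `Δ` is
slim and elastic, and `Π` is slim but not elastic. [cite: MochizukiAbsTopI2012, Prop 2.3 p.19] -/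
theorem prop22_prop23_of_isOpen_proSigma_hyperbolic_mlf (B : E.MLFBase) (hS : Sigma.Nonempty)
    (hSp : ∀ p ∈ Sigma, p.Prime) (hgr : PuncturedSurfaceGroup.IsHyperbolicType g r) (U : Subgroup E.geom)
    (hUo : IsOpen (U : Set E.geom)) (ι : PuncturedSurfaceGroup g r →* U) (hι : IsProSigmaCompletion Sigma ι)
    (hfin : ∀ N : Subgroup E.geom, N.Normal → (N : Set E.geom).Finite → N = ⊥) :
    E.GeomTFG ∧ E.GeomSlimElastic ∧ E.ArithSlimNotElastic := by
  haveI : CompactSpace E.geom := isCompact_iff_compactSpace.mp E.isClosed_geom.isCompact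
  haveI : CompactSpace U := isCompact_iff_compactSpace.mp (Subgroup.isClosed_of_isOpen U hUo).isCompact
  have htfg : E.GeomTFG := E.geomTFG_of_isOpen_subgroup U hUo
    (IsProSigmaCompletion.isTopologicallyFinitelyGenerated_of_puncturedSurfaceGroup (MulEquiv.refl _) hι)
  have hse : E.GeomSlimElastic := E.geomSlimElastic_of_isOpen_proSigma_hyperbolic hS hSp hgr U hUo ι hι hfin
  obtain ⟨ℓ, hℓ⟩ := hS
  have hne := E.geom_ne_bot_of_isOpen_proSigma_hyperbolic ⟨ℓ, hℓ, hSp ℓ hℓ⟩ hgr U hUo ι hι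
  exact ⟨htfg, hse, B.arithSlimNotElastic' hse.1 hne htfg⟩

/-- **The same at the ALMOST pro-`Σ` model, NF base.** [cite: MochizukiAbsTopI2012, Prop 2.3 p.19] -/
theorem prop22_prop23_of_isOpen_proSigma_hyperbolic_nf (B : E.NFBase) (hS : Sigma.Nonempty)
    (hSp : ∀ p ∈ Sigma, p.Prime) (hgr : PuncturedSurfaceGroup.IsHyperbolicType g r) (U : Subgroup E.geom)
    (hUo : IsOpen (U : Set E.geom)) (ι : PuncturedSurfaceGroup g r →* U) (hι : IsProSigmaCompletion Sigma ι)
    (hfin : ∀ N : Subgroup E.geom, N.Normal → (N : Set E.geom).Finite → N = ⊥) :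
    E.GeomTFG ∧ E.GeomSlimElastic ∧ E.ArithSlimNotElastic := by
  haveI : CompactSpace E.geom := isCompact_iff_compactSpace.mp E.isClosed_geom.isCompact
  haveI : CompactSpace U := isCompact_iff_compactSpace.mp (Subgroup.isClosed_of_isOpen U hUo).isCompact
  have htfg : E.GeomTFG := E.geomTFG_of_isOpen_subgroup U hUo
    (IsProSigmaCompletion.isTopologicallyFinitelyGenerated_of_puncturedSurfaceGroup (MulEquiv.refl _) hι)
  have hse : E.GeomSlimElastic := E.geomSlimElastic_of_isOpen_proSigma_hyperbolic hS hSp hgr U hUo ι hι hfin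
  obtain ⟨ℓ, hℓ⟩ := hS
  have hne := E.geom_ne_bot_of_isOpen_proSigma_hyperbolic ⟨ℓ, hℓ, hSp ℓ hℓ⟩ hgr U hUo ι hι
  exact ⟨htfg, hse, B.arithSlimNotElastic' hse.1 hne htfg⟩

end FundamentalExtension

end Literature.AnabelianGeometry.AbsoluteAnabelian

end
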